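import Literature.NumberTheory.EllipticCurves.OggFormulaTypeIstarProofs
import Literature.NumberTheory.EllipticCurves.HasseWeilAbelianPotentialGoodReductionProofs
import Literature.NumberTheory.EllipticCurves.HasseWeilAbelianTameIntegralJProofs
import Literature.NumberTheory.EllipticCurves.NeronComponentIndexTypeIIIProofs
import Literature.NumberTheory.EllipticCurves.NeronComponentIndexTypeIIIstarProofs
import Literature.NumberTheory.EllipticCurves.SelmerFiniteProofs
import Literature.NumberTheory.EllipticCurves.SelmerInertiaProofs
import Literature.NumberTheory.EllipticCurves.NeronOggShafarevichLocal
import HarnessLib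

/-!
# Kodaira types `III`, `III*` at a place `v ∤ 2`: good reduction over `K_v(π^{1/4})`, tameness of
# `V_ℓ E`, and Ogg's formula at these places (Silverman *ATAEC* IV.11.1, `p = 3`, types III, III*)

`Proofs` file (theorems only, no definitions, no named facts, no instances) in topic
`NumberTheory/EllipticCurves`, landed by the tenured seat of bsd.S15
(`Literature.NumberTheory.EllipticCurves.conductorNorm_eq_artinConductorNat`) as a bottom-up step in
the printed proof of Ogg's formula at the additive places of residue characteristic `3`
(Silverman, *ATAEC*, Thm. IV.11.1, case `p = 3`, PDF pp. 366–371), types `III` and `III*`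
(p. 367): *"We claim that `L/K` is at worst tamely ramified … Hence … `δ(E/K) = 0`"*, where the
book rescales the `2`-division cubic by the uniformiser `π_M = π_K^{-1}√Δ` of `M = K(√Δ)`.  In
Galois form and for every `ℓ`: over the **tame** extension `K_v(π^{1/4})` (degree `4`, prime to
the odd residue characteristic) a curve of type `III` or `III*` acquires good reduction —
`(x, y) ↦ (ϖ²x, ϖ³y)`, resp. `(ϖ⁶x, ϖ⁹y)`, `ϖ⁴ = π`, on the completed-square normal form —, so the
wild ramification groups, which are pro-`p` and therefore act trivially on the `2`-power extension
`K(π^{1/4}, μ₄)`, lie in the inertia group of that field and fix the prime-to-`v` torsion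
(*AEC* VII.4.1 / X.4.2 reduction step over the valued field `K̄_v`,
`map_eq_of_inertia_of_zsmul_sub_eq_zero`): `V_ℓ E` is tame and `Sw_𝔓(V_ℓ E) = 0 = δ_v`.

## Main results

* `Literature.NumberTheory.EllipticCurves.algEquiv_eq_one_of_odd_of_eq_adjoin_rootSet_four`,
  `…smul_eq_self_of_mem_absUpperRamificationSubgroup_of_mem_adjoin_rootSet_four` — the Galois group
  of `K(rootSet(X⁴ - c))/K` is a `2`-group: an automorphism of odd order is trivial; hence at a
  place of **odd** residue characteristic every element of a wild ramification group `Γ_K^u(𝔓)`,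
  `u > 0`, fixes `K(rootSet(X⁴ - c))` pointwise (the `X¹²`-version of
  `HasseWeilAbelianPotentialGoodReductionProofs` needs `p ≠ 2, 3`);
* `WeierstrassCurve.smul_localPoints_eq_of_mem_inertia_of_model` — **potential good reduction
  realised inside `K̄_v`**: if over an intermediate field `F` of `K̄_v/K_v` some change of variables
  turns `E` into a `|·|_v`-integral equation with unit discriminant, then every `σ ∈ I_𝔐 ≤ Γ_{K_v}`
  fixing `F` pointwise fixes the prime-to-`v` torsion of `E(K̄_v)`;
* `WeierstrassCurve.exists_model_adjoin_root_four_of_kodairaSymbolAt_eq_III` /`_IIIstar` — for type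
  `III` (`III*`) at `v ∤ 2` and `ϖ ∈ K̄_v` with `ϖ⁴ = π`, such a model over `F = K_v(ϖ)`;
* `WeierstrassCurve.smul_torsion_eq_self_of_mem_absUpperRamificationSubgroup_of_model`,
  `…_of_kodairaSymbolAt_eq_III` /`_IIIstar` — over a number field: the wild ramification groups
  `Γ_K^u(𝔓)`, `u > 0`, fix the prime-to-`v` torsion of `E(K̄)` (local–global passage through an
  embedding `K̄ → K̄_v`, `exists_mem_inertia_apply_eq_holds`);
* `WeierstrassCurve.isTameAt_rationalTate_of_kodairaSymbolAt_eq_III_or_IIIstar`,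
  `…swanConductorAt_rationalTate_eq_wildConductorExponent_of_kodairaSymbolAt_eq_III_or_IIIstar` —
  at `v ∤ 2ℓ` of type `III` or `III*`: **`V_ℓ E` is tame**, `Sw_𝔓(V_ℓ E) = 0`, and with
  `δ_v = 0` (`wildConductorExponent_eq_zero_of_kodairaSymbolAt`, `TateAlgorithmTameTypesOddProofs`)
  **Ogg's formula in Galois form holds there**;
* `WeierstrassCurve.swanConductorAt_rationalTate_eq_wildConductorExponent_of_ringChar_eq_three_of_wildTypes`
  — the named fact `…_of_ringChar_eq_three W ℓ` (Ogg at `p = 3`) reduced to the additive places of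
  residue characteristic `3` of Kodaira type `II, IV, IV*, II*` (the genuinely wild types); with
  `OggFormulaTypeIstarProofs` the tame columns `III, III*, I₀*, Iₙ*` of Silverman's proof are now
  theorems for every `ℓ`.

## References

* [SilvermanATAEC1994] J. H. Silverman, *Advanced Topics in the Arithmetic of Elliptic Curves*,
  GTM 151: IV.9.4 Steps 4, 9 (types `III`, `III*`), Table 4.1; proof of Thm. IV.11.1 for `p = 3`,
  types `III`, `III*` (PDF p. 367); Thm. IV.10.2(b) and its proof (PDF pp. 358–362).
* [SilvermanAEC2009] J. H. Silverman, *The Arithmetic of Elliptic Curves*, 2nd ed.: VII.4.1,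
  VII.5.4–5.5 (potential good reduction), X.4 (proof of Thm. 4.2(b)).
* [SerreLocalFields1979] J.-P. Serre, *Local Fields*, Ch. IV §2 Cor. 3 of Prop. 7 (`G_1` is a
  `p`-group).

## Design

Pure theorems; `noncomputable section`; one universe `u`.  §1 field theory (namespace
`Literature.NumberTheory.EllipticCurves`); §§2–4 in `namespace WeierstrassCurve` over a number field
`K`, with `L = K̄_v`, the spectral valuation `w` (`exists_spectralValuation`, hypothesis `hw`) and
intermediate fields `F ≤ L` over `K_v`.  Axioms: `propext`, `Classical.choice`, `Quot.sound`.
-/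

noncomputable section

open scoped Classical NumberField Polynomial NNReal Pointwise
open Field IsDedekindDomain IsLocalRing Polynomial

universe u

/-! ## §1. `Gal(K(rootSet(X⁴ - c))/K)` is a `2`-group -/

namespace Literature.NumberTheory.EllipticCurves

/-- **An automorphism of odd order of `E = K(rootSet(X⁴ - c))` is trivial** (`c ≠ 0`): it fixes
`μ₄(E)` (`apply_eq_self_of_pow_twelve_eq_one`, as `x⁴ = 1 ⇒ x¹² = 1`), so for a root `r`,
`γ r = η r` with `η⁴ = 1`, `γ^N r = η^N r`, `η^N = 1 = η⁴`, `η = 1` (`N` odd); and `E` is generated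
by the roots.  (So `[E : K]` is a power of `2`.) [folklore] -/
theorem algEquiv_eq_one_of_odd_of_eq_adjoin_rootSet_four {K : Type*} [Field K] {Ω : Type*}
    [Field Ω] [Algebra K Ω] {c : K} (hc : c ≠ 0) {E : IntermediateField K Ω}
    (hE : E = IntermediateField.adjoin K ((X ^ 4 - C c : K[X]).rootSet Ω))
    (γ : E ≃ₐ[K] E) {N : ℕ} (hN : Odd N) (hγ : γ ^ N = 1) : γ = 1 := by
  have hN4 : N.Coprime 4 := by
    have h2 : N.Coprime 2 := Nat.coprime_two_right.mpr hN
    simpa using h2.pow_right 2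
  -- `γ` fixes every root of `X^4 - c`
  have hroot : ∀ (r : Ω) (hr : r ∈ (X ^ 4 - C c : K[X]).rootSet Ω),
      γ ⟨r, hE.ge (IntermediateField.subset_adjoin K _ hr)⟩ =
        ⟨r, hE.ge (IntermediateField.subset_adjoin K _ hr)⟩ := by
    intro r hr
    have hr4 : r ^ 4 = algebraMap K Ω c := by
      have := (mem_rootSet.mp hr).2
      simp only [map_sub, aeval_X_pow, aeval_C, sub_eq_zero] at this
      exact this
    have hr0 : r ≠ 0 := by
      rintro rfl
      rw [zero_pow (by norm_num)] at hr4
      exact hc ((map_eq_zero_iff _ (algebraMap K Ω).injective).mp hr4.symm)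
    set r' : E := ⟨r, hE.ge (IntermediateField.subset_adjoin K _ hr)⟩ with hr'
    have hr'0 : r' ≠ 0 := fun h ↦ hr0 (congrArg Subtype.val h)
    have hr'4 : r' ^ 4 = algebraMap K E c := Subtype.ext hr4
    set η : E := γ r' / r' with hη
    have hγr : γ r' = η * r' := by rw [hη, div_mul_cancel₀ _ hr'0]
    have hη4 : η ^ 4 = 1 := by
      rw [hη, div_pow, ← map_pow, hr'4, AlgEquiv.commutes, div_self]
      rw [map_ne_zero_iff _ (algebraMap K E).injective]
      exact hc
    have hη12 : η ^ 12 = 1 := by rw [show 12 = 4 * 3 by norm_num, pow_mul, hη4, one_pow]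
    have hγη : γ η = η := apply_eq_self_of_pow_twelve_eq_one γ hN hγ hη12
    have hiter : ∀ k : ℕ, (γ ^ k) r' = η ^ k * r' := by
      intro k
      induction k with
      | zero => simp
      | succ k ih =>
        rw [pow_succ', AlgEquiv.mul_apply, ih, map_mul, map_pow, hγη, hγr, pow_succ]
        ring
    have hηN : η ^ N = 1 := by
      have := hiter N
      rw [hγ, AlgEquiv.one_apply] at this
      exact (mul_eq_right₀ hr'0).mp this.symm
    have hη1 : η = 1 := by
      have := pow_gcd_eq_one.mpr ⟨hηN, hη4⟩
      rwa [Nat.Coprime.gcd_eq_one hN4, pow_one] at this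
    rw [hγr, hη1, one_mul]
  -- `E` is generated by the roots
  have key : (γ : E →ₐ[K] E) = AlgHom.id K E :=
    IntermediateField.algHom_ext_of_eq_adjoin K hE (fun r hr ↦ by
      rw [AlgHom.id_apply]
      exact hroot r hr)
  refine AlgEquiv.ext fun x ↦ ?_
  have := congrArg (fun f : E →ₐ[K] E ↦ f x) key
  simpa using this

/-- **An element of a wild ramification group restricts trivially to `E = K(rootSet(X⁴ - c))`
at odd residue characteristic.**  For a number field `K`, `c ≠ 0`, a finite place `v ∤ 2`, a
prime `𝔓 ∣ v` of `\bar ℤ_K`, `u > 0` and `σ ∈ Γ_K^u(𝔓)`: `σ` fixes `E` pointwise — `σ|_E` lies in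
`Gal(E/K)^u ≤ G_1`, a `p`-group (`isPGroup_ramificationSubgroup_one_of_mem_primesAbove`), so has
odd order and is trivial (`algEquiv_eq_one_of_odd_of_eq_adjoin_rootSet_four`).
[cite: SerreLocalFields1979, Ch. IV §2 Cor. 3 of Prop. 7 and §3 Remark 1] -/
theorem smul_eq_self_of_mem_absUpperRamificationSubgroup_of_mem_adjoin_rootSet_four
    {K : Type u} [Field K] [NumberField K] {c : K} (hc : c ≠ 0)
    {v : HeightOneSpectrum (𝓞 K)} (h2 : (2 : 𝓞 K) ∉ v.asIdeal)
    {𝔓 : Ideal (GaloisRepresentations.absIntegers (𝓞 K) K)} (h𝔓 : 𝔓 ∈ v.primesAbove) {u : ℝ}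
    (hu : 0 < u) {σ : absoluteGaloisGroup K}
    (hσ : σ ∈ GaloisRepresentations.absUpperRamificationSubgroup (𝓞 K) 𝔓 u)
    {x : AlgebraicClosure K}
    (hx : x ∈ IntermediateField.adjoin K ((X ^ 4 - C c : K[X]).rootSet (AlgebraicClosure K))) :
    σ • x = x := by
  set E : IntermediateField K (AlgebraicClosure K) :=
    IntermediateField.adjoin K ((X ^ 4 - C c : K[X]).rootSet (AlgebraicClosure K)) with hE
  haveI hsf : (X ^ 4 - C c : K[X]).IsSplittingField K E :=
    IntermediateField.adjoin_rootSet_isSplittingField (IsAlgClosed.splits _)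
  haveI : Normal K E := Normal.of_isSplittingField (X ^ 4 - C c : K[X])
  haveI : FiniteDimensional K E := Polynomial.IsSplittingField.finiteDimensional E (X ^ 4 - C c : K[X])
  haveI : IsGalois K E := IsGalois.mk
  -- the residue characteristic `p` is an odd prime
  have hp : (ringChar (𝓞 K ⧸ v.asIdeal)).Prime := by
    haveI : Finite (𝓞 K ⧸ v.asIdeal) := Ideal.finiteQuotientOfFreeOfNeBot v.asIdeal v.ne_bot
    exact CharP.char_is_prime (𝓞 K ⧸ v.asIdeal) _
  have hmem : ((ringChar (𝓞 K ⧸ v.asIdeal) : ℕ) : 𝓞 K) ∈ v.asIdeal := by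
    rw [← Ideal.Quotient.eq_zero_iff_mem, map_natCast]
    exact ringChar.Nat.cast_ringChar
  have hp2 : ringChar (𝓞 K ⧸ v.asIdeal) ≠ 2 := fun h ↦ h2 (by simpa [h] using hmem)
  have hodd : Odd (ringChar (𝓞 K ⧸ v.asIdeal)) := hp.odd_of_ne_two hp2
  -- `σ|_E ∈ G_1`, a `p`-group
  have h1 : GaloisRepresentations.absRestrictNormalHom E σ ∈
      (𝔓.comap (E.integralClosureToAbsIntegers (𝓞 K))).ramificationSubgroup (E ≃ₐ[K] E) 1 :=
    GaloisRepresentations.upperRamificationSubgroup_le_ramificationSubgroup_one _ _ hu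
      ((GaloisRepresentations.mem_absUpperRamificationSubgroup_iff.mp hσ) E)
  obtain ⟨t, ht⟩ := isPGroup_ramificationSubgroup_one_of_mem_primesAbove h𝔓 E ⟨_, h1⟩
  have hpow : GaloisRepresentations.absRestrictNormalHom E σ ^ ringChar (𝓞 K ⧸ v.asIdeal) ^ t = 1 := by
    have := congrArg Subtype.val ht
    simpa using this
  have hσE : GaloisRepresentations.absRestrictNormalHom E σ = 1 :=
    algEquiv_eq_one_of_odd_of_eq_adjoin_rootSet_four hc hE _ (hodd.pow) hpow
  -- hence `σ` fixes `E` pointwise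
  have hcomm := AlgEquiv.restrictNormal_commutes (absoluteGaloisGroup.toAlgEquiv K σ) E ⟨x, hx⟩
  have hres : (absoluteGaloisGroup.toAlgEquiv K σ).restrictNormal E =
      GaloisRepresentations.absRestrictNormalHom E σ := rfl
  rw [hres, hσE, AlgEquiv.one_apply] at hcomm
  rw [absoluteGaloisGroup.smul_def]
  exact hcomm.symm

end Literature.NumberTheory.EllipticCurves

/-! ## §2. Potential good reduction realised inside `K̄_v`: inertia elements fixing the field of
definition of a good model fix the prime-to-`v` torsion -/

namespace WeierstrassCurve

open Literature.NumberTheory.EllipticCurves Literature.NumberTheory.GaloisRepresentations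
  Literature.NumberTheory.DiophantineGeometry Literature.NumberTheory.DiophantineGeometry.TateAlgorithm
  IsDedekindDomain.HeightOneSpectrum

variable {K : Type u} [Field K] [NumberField K] (W : WeierstrassCurve K)

/-- **Silverman *AEC* X.4, proof of Thm. 4.2(b), reduction step, over an extension of `K_v` inside
`K̄_v`.**  Let `E/K` be an elliptic curve over a number field, `v` a finite place, `|·|_v` the
spectral valuation of `K̄_v`, `𝔐` the prime of `\bar 𝓞_v`, `F` an intermediate field of
`K̄_v/K_v`, `C` a change of variables over `K_v` and `D` one over `F` such that
`W' = D • (C • E_{K_v})_F` is `|·|_v`-integral with unit discriminant (a good model over `F`).  Then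
every `σ` in the inertia group `I_𝔐 ≤ Γ_{K_v}` that fixes `F` pointwise fixes every `Q ∈ E(K̄_v)`
with `nQ = O`, `v ∤ n`.  Proof: the isomorphism `E(K̄_v) ≃ W'(K̄_v)` induced by `C` and `D` is
equivariant for `σ` viewed as an `F`-automorphism (`congrEquiv_smul`,
`VariableChange.pointEquivBaseChange_map_algEquiv`), and on `W'(K̄_v)` the element `σ` — an
isometry moving integers by less than `1` (`spectralValuation_smul`,
`mem_inertia_iff_spectralValuation`) — fixes the points it moves by `n`-torsion
(`map_eq_of_inertia_of_zsmul_sub_eq_zero`, `GoodReductionInertia`; `|n|_v = 1`).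
[cite: SilvermanAEC2009, X.4 proof of Thm. 4.2(b), via Prop. VII.4.1(a) and VII.5 (potential good reduction)] -/
theorem smul_localPoints_eq_of_mem_inertia_of_model [W.IsElliptic] {v : HeightOneSpectrum (𝓞 K)}
    {w : Valuation (AlgebraicClosure (v.adicCompletion K)) ℝ≥0}
    (hw : ∀ x, (w x : ℝ) =
      spectralNorm (v.adicCompletion K) (AlgebraicClosure (v.adicCompletion K)) x)
    {𝔐 : Ideal v.localAbsIntegers} (h𝔐 : 𝔐 ∈ v.localPrimesAbove)
    (F : IntermediateField (v.adicCompletion K) (AlgebraicClosure (v.adicCompletion K)))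
    (C : VariableChange (v.adicCompletion K)) (D : VariableChange F)
    [((D • ((C • W.baseChange (v.adicCompletion K)).baseChange F)).baseChange
      (AlgebraicClosure (v.adicCompletion K))).IsIntegral w.integer]
    (hΔ : w ((D • ((C • W.baseChange (v.adicCompletion K)).baseChange F)).baseChange
      (AlgebraicClosure (v.adicCompletion K))).Δ = 1)
    {σ : absoluteGaloisGroup (v.adicCompletion K)}
    (hσI : σ ∈ 𝔐.inertia (absoluteGaloisGroup (v.adicCompletion K)))
    (hσF : ∀ x : AlgebraicClosure (v.adicCompletion K), x ∈ F → σ • x = x)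
    {n : ℤ} (hn : (n : 𝓞 K) ∉ v.asIdeal) {Q : localPoints W (v.adicCompletion K)}
    (hQ : n • Q = 0) : σ • Q = Q := by
  -- notation: `Kv`, `L = K̄_v`, `σE = σ` as a `K_v`-automorphism, `τ = σ` as an `F`-automorphism
  let Kv := v.adicCompletion K
  let L := AlgebraicClosure (v.adicCompletion K)
  set σE : L ≃ₐ[Kv] L := absoluteGaloisGroup.toAlgEquiv _ σ with hσE
  have hσ₁ : ∀ z : L, w (σE z) = w z := fun z ↦ spectralValuation_smul hw σ z
  have hσ₂ : ∀ z : L, w z ≤ 1 → w (σE z - z) < 1 := (mem_inertia_iff_spectralValuation hw h𝔐).mp hσI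
  have hn' : w (n : L) = 1 := spectralValuation_intCast_eq_one hw hn
  have hστ : ∀ x : F, σE (algebraMap F L x) = algebraMap F L x := fun x ↦ hσF x.1 x.2
  let τ : L ≃ₐ[F] L := AlgEquiv.ofRingEquiv (f := σE.toRingEquiv) hστ
  have hτσ : ∀ z : L, τ z = σE z := fun _ ↦ rfl
  have hτ₁ : ∀ z : L, w (τ z) = w z := fun z ↦ by rw [hτσ]; exact hσ₁ z
  have hτ₂ : ∀ z : L, w z ≤ 1 → w (τ z - z) < 1 := fun z hz ↦ by rw [hτσ]; exact hσ₂ z hz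
  -- the curves
  set X₁ : WeierstrassCurve Kv := C • W.baseChange Kv with hX₁
  set X₁F : WeierstrassCurve F := X₁.baseChange F with hX₁F
  set W' : WeierstrassCurve F := D • X₁F with hW'
  have h₃ : X₁F.baseChange L = X₁.baseChange L := X₁.map_baseChange F.val
  -- the equivariant transport `Φ : E(K̄_v) ≃+ W'(K̄_v)`
  let Φ₁ : localPoints W Kv ≃+ ((W.baseChange Kv).baseChange L).toAffine.Point :=
    Affine.Point.congrEquiv (baseChange_baseChange_adicCompletion W v).symm
  let Φ₂ : ((W.baseChange Kv).baseChange L).toAffine.Point ≃+ (X₁.baseChange L).toAffine.Point :=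
    VariableChange.pointEquivBaseChange (W.baseChange Kv) C L
  let Φ₃ : (X₁.baseChange L).toAffine.Point ≃+ (X₁F.baseChange L).toAffine.Point :=
    Affine.Point.congrEquiv h₃.symm
  let Φ₄ : (X₁F.baseChange L).toAffine.Point ≃+ (W'.baseChange L).toAffine.Point :=
    VariableChange.pointEquivBaseChange X₁F D L
  let Φ : localPoints W Kv ≃+ (W'.baseChange L).toAffine.Point :=
    ((Φ₁.trans Φ₂).trans Φ₃).trans Φ₄
  have hΦ₁ : ∀ P, Φ₁ (σ • P) = Affine.Point.map (σE : L →ₐ[Kv] L) (Φ₁ P) :=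
    fun P ↦ congrEquiv_smul W v σ P
  have hΦ₂ : ∀ P, Φ₂ (Affine.Point.map (σE : L →ₐ[Kv] L) P) =
      Affine.Point.map (σE : L →ₐ[Kv] L) (Φ₂ P) :=
    fun P ↦ VariableChange.pointEquivBaseChange_map_algEquiv (W.baseChange Kv) C σE P
  have hΦ₃ : ∀ P, Φ₃ (Affine.Point.map (σE : L →ₐ[Kv] L) P) =
      Affine.Point.map (τ : L →ₐ[F] L) (Φ₃ P) := by
    intro P
    rcases P with _ | ⟨x, y, hxy⟩
    · change Φ₃ (Affine.Point.map _ 0) = Affine.Point.map _ (Φ₃ 0)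
      simp only [map_zero]
    · rw [Affine.Point.map_some, Affine.Point.congrEquiv_some, Affine.Point.congrEquiv_some,
        Affine.Point.map_some]
      rfl
  have hΦ₄ : ∀ P, Φ₄ (Affine.Point.map (τ : L →ₐ[F] L) P) =
      Affine.Point.map (τ : L →ₐ[F] L) (Φ₄ P) :=
    fun P ↦ VariableChange.pointEquivBaseChange_map_algEquiv X₁F D τ P
  have hΦ : ∀ P, Φ (σ • P) = Affine.Point.map (τ : L →ₐ[F] L) (Φ P) := by
    intro P
    change Φ₄ (Φ₃ (Φ₂ (Φ₁ (σ • P)))) = Affine.Point.map (τ : L →ₐ[F] L) (Φ₄ (Φ₃ (Φ₂ (Φ₁ P))))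
    rw [hΦ₁, hΦ₂, hΦ₃, hΦ₄]
  -- the reduction step on the good model `W'`
  have hnQ : n • (σ • Q - Q) = 0 := by
    rw [smul_sub, smul_comm, hQ, smul_zero, zero_sub, neg_eq_zero]
  have key := Literature.NumberTheory.EllipticCurves.map_eq_of_inertia_of_zsmul_sub_eq_zero
    (w := w) W' hΔ τ hτ₁ hτ₂ hn' (P := Φ Q) (by rw [← hΦ, ← map_sub, ← map_zsmul, hnQ, map_zero])
  apply Φ.injective
  rw [hΦ]
  exact key

/-! ## §3. The good model over `K_v(ϖ)`, `ϖ⁴ = π`, from the shape of `b₂, b₄, b₆, Δ` -/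

/-- **A good model over `K_v(ϖ)`, `ϖ⁴ = π`, from divisibilities of `b₂, b₄, b₆` and the order of
`Δ`.**  Let `C • E_{K_v}` have `b₂ = π^{e₂}β₂`, `b₄ = π^{e₄}β₄`, `b₆ = π^{e₆}β₆` (`βᵢ ∈ 𝓞_v`) and
`Δ = π^{e_Δ}δ` (`δ ∈ 𝓞_vˣ`), with `2 ∈ 𝓞_vˣ`, and let `k` satisfy `2k ≤ 4e₂`, `4k ≤ 4e₄`,
`6k ≤ 4e₆`, `12k = 4e_Δ`.  For `ϖ ∈ K̄_v` with `ϖ⁴ = π`, the change of variables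
`(ϖ^k, 0, -a₁/2, -a₃/2)` over `F = K_v(ϖ)` (complete the square, then `(x, y) ↦ (ϖ^{2k}x, ϖ^{3k}y)`)
yields `y² = x³ + b₂/(4ϖ^{2k})·x² + b₄/(2ϖ^{4k})·x + b₆/(4ϖ^{6k})`, which is `|·|_v`-integral with
discriminant `Δ/ϖ^{12k} = δ` of valuation `1`.  (Silverman *ATAEC*, proof of IV.11.1 for `p = 3`,
types `III`, `III*`, PDF p. 367: the rescaled cubic `g(x) = π_M^{-3} f(π_M x)`; here with the
fourth root of `π` so that the Weierstrass equation itself, not only the cubic, becomes integral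
with unit discriminant.)
[cite: SilvermanATAEC1994, proof of IV.11.1, p = 3, types III and III* (PDF p. 367)] -/
theorem exists_model_adjoin_root_four {v : HeightOneSpectrum (𝓞 K)}
    {w : Valuation (AlgebraicClosure (v.adicCompletion K)) ℝ≥0}
    (hw : ∀ x, (w x : ℝ) =
      spectralNorm (v.adicCompletion K) (AlgebraicClosure (v.adicCompletion K)) x)
    (C : VariableChange (v.adicCompletion K)) {π : K}
    (hπ : v.valuation K π = WithZero.exp (-1 : ℤ))
    (hu2 : IsUnit (2 : v.adicCompletionIntegers K))
    {e₂ e₄ e₆ eΔ k : ℕ} {β₂ β₄ β₆ δ : v.adicCompletionIntegers K} (hδ : IsUnit δ)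
    (hb₂ : (C • W.baseChange (v.adicCompletion K)).b₂ = (π : v.adicCompletion K) ^ e₂ * β₂)
    (hb₄ : (C • W.baseChange (v.adicCompletion K)).b₄ = (π : v.adicCompletion K) ^ e₄ * β₄)
    (hb₆ : (C • W.baseChange (v.adicCompletion K)).b₆ = (π : v.adicCompletion K) ^ e₆ * β₆)
    (hΔ : (C • W.baseChange (v.adicCompletion K)).Δ = (π : v.adicCompletion K) ^ eΔ * δ)
    (h₂ : 2 * k ≤ 4 * e₂) (h₄ : 4 * k ≤ 4 * e₄) (h₆ : 6 * k ≤ 4 * e₆) (h₁₂ : 12 * k = 4 * eΔ)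
    {ϖ : AlgebraicClosure (v.adicCompletion K)}
    (hϖ : ϖ ^ 4 = algebraMap (v.adicCompletion K) (AlgebraicClosure (v.adicCompletion K))
      (π : v.adicCompletion K)) :
    ∃ D : VariableChange (IntermediateField.adjoin (v.adicCompletion K) {ϖ}),
      ((D • ((C • W.baseChange (v.adicCompletion K)).baseChange
          (IntermediateField.adjoin (v.adicCompletion K) {ϖ}))).baseChange
        (AlgebraicClosure (v.adicCompletion K))).IsIntegral w.integer ∧
      w ((D • ((C • W.baseChange (v.adicCompletion K)).baseChange
          (IntermediateField.adjoin (v.adicCompletion K) {ϖ}))).baseChange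
        (AlgebraicClosure (v.adicCompletion K))).Δ = 1 := by
  let Kv := v.adicCompletion K
  let L := AlgebraicClosure (v.adicCompletion K)
  let O := v.adicCompletionIntegers K
  -- `π ≠ 0`, `ϖ ≠ 0`, and the field `F = K_v(ϖ)` with its generator `g`
  have hπv : Valued.v (π : Kv) = WithZero.exp (-1 : ℤ) := by
    rw [valuedAdicCompletion_eq_valuation', hπ]
  have hπ0 : (π : Kv) ≠ 0 := by
    intro h; rw [h, map_zero] at hπv; exact WithZero.exp_ne_zero hπv.symm
  have hπL0 : algebraMap Kv L (π : Kv) ≠ 0 := by rwa [map_ne_zero_iff _ (algebraMap Kv L).injective]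
  have hϖ0 : ϖ ≠ 0 := by
    rintro rfl
    rw [zero_pow (by norm_num)] at hϖ
    exact hπL0 hϖ.symm
  set F : IntermediateField Kv L := IntermediateField.adjoin Kv {ϖ} with hF
  set g : F := IntermediateField.AdjoinSimple.gen Kv ϖ with hg
  have hgL : algebraMap F L g = ϖ := IntermediateField.AdjoinSimple.algebraMap_gen Kv ϖ
  have hg0 : g ≠ 0 := by
    intro h
    apply hϖ0
    rw [← hgL, h, map_zero]
  haveI : CharZero Kv := charZero_of_injective_algebraMap (algebraMap K Kv).injective
  haveI : CharZero F := charZero_of_injective_algebraMap (algebraMap Kv F).injective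
  -- the model
  set X₁ : WeierstrassCurve Kv := C • W.baseChange Kv with hX₁
  set X₁F : WeierstrassCurve F := X₁.baseChange F with hX₁F
  set D : VariableChange F := ⟨Units.mk0 (g ^ k) (pow_ne_zero _ hg0), 0, -X₁F.a₁ / 2, -X₁F.a₃ / 2⟩
    with hD
  have hDu : ((D.u⁻¹ : Fˣ) : F) = (g ^ k)⁻¹ := by rw [Units.val_inv_eq_inv_val]; rfl
  have hDr : D.r = 0 := rfl
  have hDs : D.s = -X₁F.a₁ / 2 := rfl
  have hDt : D.t = -X₁F.a₃ / 2 := rfl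
  set W' : WeierstrassCurve F := D • X₁F with hW'
  have hWa₁ : W'.a₁ = 0 := by rw [hW', variableChange_a₁, hDu, hDs]; ring
  have hWa₃ : W'.a₃ = 0 := by rw [hW', variableChange_a₃, hDu, hDr, hDt]; ring
  have hWa₂ : W'.a₂ = (g ^ k)⁻¹ ^ 2 * (X₁F.b₂ / 4) := by
    rw [hW', variableChange_a₂, hDu, hDr, hDs, b₂]; ring
  have hWa₄ : W'.a₄ = (g ^ k)⁻¹ ^ 4 * (X₁F.b₄ / 2) := by
    rw [hW', variableChange_a₄, hDu, hDr, hDs, hDt, b₄]; ring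
  have hWa₆ : W'.a₆ = (g ^ k)⁻¹ ^ 6 * (X₁F.b₆ / 4) := by
    rw [hW', variableChange_a₆, hDu, hDr, hDt, b₆]; ring
  have hWΔ : W'.Δ = (g ^ k)⁻¹ ^ 12 * X₁F.Δ := by rw [hW', variableChange_Δ, hDu]
  -- the coefficients of `W'_L`, in terms of `ϖ`
  have hmapKv : ∀ x : Kv, algebraMap F L (algebraMap Kv F x) = algebraMap Kv L x :=
    fun x ↦ (IsScalarTower.algebraMap_apply Kv F L x).symm
  have hπϖ : ∀ e : ℕ, algebraMap Kv L ((π : Kv) ^ e) = ϖ ^ (4 * e) := fun e ↦ by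
    rw [map_pow, ← hϖ, ← pow_mul]
  have hLb₂ : algebraMap F L X₁F.b₂ = ϖ ^ (4 * e₂) * algebraMap Kv L (β₂ : Kv) := by
    rw [hX₁F, WeierstrassCurve.baseChange, map_b₂, hmapKv, hb₂, map_mul, hπϖ]
  have hLb₄ : algebraMap F L X₁F.b₄ = ϖ ^ (4 * e₄) * algebraMap Kv L (β₄ : Kv) := by
    rw [hX₁F, WeierstrassCurve.baseChange, map_b₄, hmapKv, hb₄, map_mul, hπϖ]
  have hLb₆ : algebraMap F L X₁F.b₆ = ϖ ^ (4 * e₆) * algebraMap Kv L (β₆ : Kv) := by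
    rw [hX₁F, WeierstrassCurve.baseChange, map_b₆, hmapKv, hb₆, map_mul, hπϖ]
  have hLΔ : algebraMap F L X₁F.Δ = ϖ ^ (4 * eΔ) * algebraMap Kv L (δ : Kv) := by
    rw [hX₁F, WeierstrassCurve.baseChange, map_Δ, hmapKv, hΔ, map_mul, hπϖ]
  have hgk : ∀ m : ℕ, algebraMap F L ((g ^ k)⁻¹ ^ m) = (ϖ ^ (k * m))⁻¹ := fun m ↦ by
    rw [map_pow, map_inv₀, map_pow, hgL, inv_pow, ← pow_mul]
  have hA₁ : (W'.baseChange L).a₁ = 0 := by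
    rw [WeierstrassCurve.baseChange, map_a₁, hWa₁, map_zero]
  have hA₃ : (W'.baseChange L).a₃ = 0 := by
    rw [WeierstrassCurve.baseChange, map_a₃, hWa₃, map_zero]
  have hA₂ : (W'.baseChange L).a₂ = (ϖ ^ (k * 2))⁻¹ * (ϖ ^ (4 * e₂) * algebraMap Kv L (β₂ : Kv) / 4) := by
    rw [WeierstrassCurve.baseChange, map_a₂, hWa₂, map_mul, hgk, map_div₀, hLb₂, map_ofNat]
  have hA₄ : (W'.baseChange L).a₄ = (ϖ ^ (k * 4))⁻¹ * (ϖ ^ (4 * e₄) * algebraMap Kv L (β₄ : Kv) / 2) := by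
    rw [WeierstrassCurve.baseChange, map_a₄, hWa₄, map_mul, hgk, map_div₀, hLb₄, map_ofNat]
  have hA₆ : (W'.baseChange L).a₆ = (ϖ ^ (k * 6))⁻¹ * (ϖ ^ (4 * e₆) * algebraMap Kv L (β₆ : Kv) / 4) := by
    rw [WeierstrassCurve.baseChange, map_a₆, hWa₆, map_mul, hgk, map_div₀, hLb₆, map_ofNat]
  have hAΔ : (W'.baseChange L).Δ = algebraMap Kv L (δ : Kv) := by
    rw [WeierstrassCurve.baseChange, map_Δ, hWΔ, map_mul, hgk, hLΔ, ← mul_assoc,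
      show k * 12 = 4 * eΔ by omega, inv_mul_cancel₀ (pow_ne_zero _ hϖ0), one_mul]
  -- valuations
  have hle : ∀ β : O, w (algebraMap Kv L (β : Kv)) ≤ 1 := fun β ↦
    (spectralValuation_algebraMap_le_one_iff hw _).mpr β.2
  have hδ1 : w (algebraMap Kv L (δ : Kv)) = 1 := spectralValuation_eq_one_of_isUnit hw hδ
  have h21 : w (2 : L) = 1 := by
    have := spectralValuation_eq_one_of_isUnit hw hu2
    rwa [map_ofNat, map_ofNat] at this
  have h41 : w (4 : L) = 1 := by rw [show (4 : L) = 2 * 2 by norm_num, map_mul, h21, one_mul]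
  have hπ1 : w (algebraMap Kv L (π : Kv)) ≤ 1 :=
    (spectralValuation_algebraMap_le_one_iff hw _).mpr ((mem_adicCompletionIntegers _ _ _).mpr
      (by rw [hπv, ← WithZero.exp_zero, WithZero.exp_le_exp]; norm_num))
  have hϖ1 : w ϖ ≤ 1 := by
    rw [← pow_le_one_iff (by norm_num : (4 : ℕ) ≠ 0), ← map_pow, hϖ]; exact hπ1
  have hϖne : w ϖ ≠ 0 := (Valuation.ne_zero_iff w).mpr hϖ0
  have hϖpos : ∀ m : ℕ, 0 < w ϖ ^ m := fun m ↦ pow_pos (zero_lt_iff.mpr hϖne) m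
  -- the generic estimate: `|ϖ^{-a} (ϖ^b β / c)| ≤ 1` when `a ≤ b`, `|β| ≤ 1`, `|c| = 1`
  have est : ∀ {a b : ℕ} {β c : L}, a ≤ b → w β ≤ 1 → w c = 1 →
      w ((ϖ ^ a)⁻¹ * (ϖ ^ b * β / c)) ≤ 1 := by
    intro a b β c hab hβ hc
    rw [map_mul, map_inv₀, map_div₀, hc, div_one, map_mul, map_pow, map_pow,
      inv_mul_le_iff₀ (hϖpos a), mul_one]
    calc w ϖ ^ b * w β ≤ w ϖ ^ b * 1 := mul_le_mul_right hβ _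
      _ = w ϖ ^ b := mul_one _
      _ ≤ w ϖ ^ a := pow_le_pow_right_of_le_one' hϖ1 hab
  refine ⟨D, ?_, ?_⟩
  · exact Literature.NumberTheory.EllipticCurves.isIntegral_integer_of_val_le_one
      (by rw [hA₁, map_zero]; exact zero_le_one)
      (by rw [hA₂]; exact est (by omega) (hle β₂) h41)
      (by rw [hA₃, map_zero]; exact zero_le_one)
      (by rw [hA₄]; exact est (by omega) (hle β₄) h21)
      (by rw [hA₆]; exact est (by omega) (hle β₆) h41)
  · rw [hAΔ, hδ1]

/-! ### The shapes of `b₂, b₄, b₆, Δ` for the Kodaira types `III` and `III*` -/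

section Dedekind

variable {A : Type*} [CommRing A] [IsDedekindDomain A] {K' : Type*} [Field K'] [Algebra A K']
  [IsFractionRing A K'] (v : HeightOneSpectrum A) (X : WeierstrassCurve K')

/-- **Type `III` at `v ∤ 2`: `b₂ = πβ₂`, `b₄ = πβ₄`, `b₆ = π²β₆`, `Δ = π³δ` on a `K_v`-model.**
(The `III` normal form `π ∣ a₁, a₂, a₃, a₄`, `π² ∤ a₄`, `π² ∣ a₆` of Silverman *ATAEC* IV.9.4
Step 4, `LocalIndex.exists_smul_of_kodairaSymbolOfMinimal_eq_III`, with `ord Δ = 3`,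
`addVal_Δ_toNat_eq_three_of_kodairaSymbolOfMinimal_eq_III`; cf. PDF p. 367: "`v_K(a₂) ≥ 1`,
`v_K(a₄) = 1`, `v_K(a₆) ≥ 2`, and `v_K(Δ) = 3`".)
[cite: SilvermanATAEC1994, IV.9.4 Step 4 and proof of IV.11.1, p = 3, type III (PDF p. 367)] -/
theorem exists_variableChange_b_of_kodairaSymbolAt_eq_III [X.IsElliptic]
    [PerfectField (IsLocalRing.ResidueField (v.adicCompletionIntegers K'))]
    (h2 : ringChar (A ⧸ v.asIdeal) ≠ 2) (hT : X.kodairaSymbolAt v = .III)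
    {π : K'} (hπ : v.valuation K' π = WithZero.exp (-1 : ℤ)) :
    ∃ (C : VariableChange (v.adicCompletion K')) (β₂ β₄ β₆ δ : v.adicCompletionIntegers K'),
      IsUnit δ ∧
      (C • X.baseChange (v.adicCompletion K')).b₂ = (π : v.adicCompletion K') ^ 1 * β₂ ∧
      (C • X.baseChange (v.adicCompletion K')).b₄ = (π : v.adicCompletion K') ^ 1 * β₄ ∧
      (C • X.baseChange (v.adicCompletion K')).b₆ = (π : v.adicCompletion K') ^ 2 * β₆ ∧
      (C • X.baseChange (v.adicCompletion K')).Δ = (π : v.adicCompletion K') ^ 3 * δ := by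
  set O := v.adicCompletionIntegers K' with hO
  have hu2 : IsUnit (2 : O) := HeightOneSpectrum.isUnit_two_adicCompletionIntegers K' v h2
  have hπv : Valued.v (π : v.adicCompletion K') = WithZero.exp (-1 : ℤ) := by
    rw [valuedAdicCompletion_eq_valuation', hπ]
  set ϖ : O := ⟨(π : v.adicCompletion K'), by
    rw [mem_adicCompletionIntegers, hπv, ← WithZero.exp_zero, WithZero.exp_le_exp]; norm_num⟩
    with hϖdef
  have hϖ : Irreducible ϖ := irreducible_adicCompletionIntegers_of_valued_eq v ϖ hπv
  set M := X.localMinimalIntegralModel v with hM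
  have hΔM0 : M.Δ ≠ 0 := localMinimalIntegralModel_Δ_ne_zero v X
  rw [kodairaSymbolAt_def] at hT
  have hordM : (IsDiscreteValuationRing.addVal O M.Δ).toNat = 3 :=
    addVal_Δ_toNat_eq_three_of_kodairaSymbolOfMinimal_eq_III hu2 M hT
  obtain ⟨D, hN1, hN2, hN3, hN4, -, hN6⟩ :=
    LocalIndex.exists_smul_of_kodairaSymbolOfMinimal_eq_III M hT
  set N := D • M with hN
  have hN1' : N.a₁ ∈ maximalIdeal O ^ 1 := by rwa [pow_one]
  have hN2' : N.a₂ ∈ maximalIdeal O ^ 1 := by rwa [pow_one]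
  have hN3' : N.a₃ ∈ maximalIdeal O ^ 1 := by rwa [pow_one]
  have hN4' : N.a₄ ∈ maximalIdeal O ^ 1 := by rwa [pow_one]
  have hb₂ : N.b₂ ∈ maximalIdeal O ^ 1 := OggBound.b₂_mem_pow N (n₁ := 1) (n₂ := 1) hN1' hN2'
  have hb₄ : N.b₄ ∈ maximalIdeal O ^ 1 :=
    OggBound.b₄_mem_pow N (n₁ := 1) (n₃ := 1) (n₄ := 1) hN1' hN3' hN4'
  have hb₆ : N.b₆ ∈ maximalIdeal O ^ 2 := OggBound.b₆_mem_pow N (n₃ := 1) (n₆ := 2) hN3' hN6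
  obtain ⟨β₂, hβ₂⟩ := (mem_maximalIdeal_pow_iff_dvd_of_irreducible hϖ _ _).mp hb₂
  obtain ⟨β₄, hβ₄⟩ := (mem_maximalIdeal_pow_iff_dvd_of_irreducible hϖ _ _).mp hb₄
  obtain ⟨β₆, hβ₆⟩ := (mem_maximalIdeal_pow_iff_dvd_of_irreducible hϖ _ _).mp hb₆
  obtain ⟨n, u₀, hMu⟩ := IsDiscreteValuationRing.eq_unit_mul_pow_irreducible hΔM0 hϖ
  have hn3 : n = 3 := by
    have h := IsDiscreteValuationRing.addVal_def M.Δ u₀ hϖ n hMu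
    rw [h] at hordM
    simpa using hordM
  rw [hn3] at hMu
  have hΔN : N.Δ = ϖ ^ 3 * (↑D.u⁻¹ ^ 12 * ↑u₀) := by
    rw [hN, variableChange_Δ, hMu]; ring
  have hδ : IsUnit ((↑D.u⁻¹ ^ 12 * ↑u₀ : O)) := ((Units.isUnit _).pow 12).mul (Units.isUnit _)
  obtain ⟨C₀, hC₀⟩ : ∃ C₀ : VariableChange (v.adicCompletion K'),
      C₀ • X.baseChange (v.adicCompletion K') = X.localMinimalModel v := ⟨_, rfl⟩
  have hMK : M.map (algebraMap O (v.adicCompletion K')) = X.localMinimalModel v := by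
    rw [hM, localMinimalIntegralModel]
    exact baseChange_integralModel_eq O (X.localMinimalModel v)
  have hNK : N.map (algebraMap O (v.adicCompletion K')) =
      (D.map (algebraMap O (v.adicCompletion K')) * C₀) • X.baseChange (v.adicCompletion K') := by
    rw [mul_smul, hC₀, ← hMK, hN, map_variableChange]
  refine ⟨D.map (algebraMap O (v.adicCompletion K')) * C₀, β₂, β₄, β₆, _, hδ, ?_, ?_, ?_, ?_⟩
  · rw [← hNK, map_b₂, hβ₂, map_mul, map_pow]; rfl
  · rw [← hNK, map_b₄, hβ₄, map_mul, map_pow]; rfl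
  · rw [← hNK, map_b₆, hβ₆, map_mul, map_pow]; rfl
  · rw [← hNK, map_Δ, hΔN, map_mul, map_pow]; rfl

/-- **Type `III*` at `v ∤ 2`: `b₂ = π²β₂`, `b₄ = π³β₄`, `b₆ = π⁵β₆`, `Δ = π⁹δ` on a
`K_v`-model.**  (The `III*` normal form `π ∣ a₁`, `π² ∣ a₂`, `π³ ∣ a₃, a₄`, `π⁴ ∤ a₄`, `π⁵ ∣ a₆`
of Silverman *ATAEC* IV.9.4 Step 9, `LocalIndex.exists_smul_of_kodairaSymbolOfMinimal_eq_IIIstar`,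
with `ord Δ = 9`, `addVal_Δ_toNat_eq_nine_of_kodairaSymbolOfMinimal_eq_IIIstar`; PDF p. 367:
"`v_K(Δ) = 9` and … `K(E[2])` is tamely ramified over `K`".)
[cite: SilvermanATAEC1994, IV.9.4 Step 9 and proof of IV.11.1, p = 3, type III* (PDF p. 367)] -/
theorem exists_variableChange_b_of_kodairaSymbolAt_eq_IIIstar [X.IsElliptic]
    [PerfectField (IsLocalRing.ResidueField (v.adicCompletionIntegers K'))]
    (h2 : ringChar (A ⧸ v.asIdeal) ≠ 2) (hT : X.kodairaSymbolAt v = .IIIstar)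
    {π : K'} (hπ : v.valuation K' π = WithZero.exp (-1 : ℤ)) :
    ∃ (C : VariableChange (v.adicCompletion K')) (β₂ β₄ β₆ δ : v.adicCompletionIntegers K'),
      IsUnit δ ∧
      (C • X.baseChange (v.adicCompletion K')).b₂ = (π : v.adicCompletion K') ^ 2 * β₂ ∧
      (C • X.baseChange (v.adicCompletion K')).b₄ = (π : v.adicCompletion K') ^ 3 * β₄ ∧
      (C • X.baseChange (v.adicCompletion K')).b₆ = (π : v.adicCompletion K') ^ 5 * β₆ ∧
      (C • X.baseChange (v.adicCompletion K')).Δ = (π : v.adicCompletion K') ^ 9 * δ := by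
  set O := v.adicCompletionIntegers K' with hO
  have hu2 : IsUnit (2 : O) := HeightOneSpectrum.isUnit_two_adicCompletionIntegers K' v h2
  have hπv : Valued.v (π : v.adicCompletion K') = WithZero.exp (-1 : ℤ) := by
    rw [valuedAdicCompletion_eq_valuation', hπ]
  set ϖ : O := ⟨(π : v.adicCompletion K'), by
    rw [mem_adicCompletionIntegers, hπv, ← WithZero.exp_zero, WithZero.exp_le_exp]; norm_num⟩
    with hϖdef
  have hϖ : Irreducible ϖ := irreducible_adicCompletionIntegers_of_valued_eq v ϖ hπv
  set M := X.localMinimalIntegralModel v with hM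
  have hΔM0 : M.Δ ≠ 0 := localMinimalIntegralModel_Δ_ne_zero v X
  rw [kodairaSymbolAt_def] at hT
  have hordM : (IsDiscreteValuationRing.addVal O M.Δ).toNat = 9 :=
    addVal_Δ_toNat_eq_nine_of_kodairaSymbolOfMinimal_eq_IIIstar hu2 M hT
  obtain ⟨D, hN1, hN2, hN3, hN4, -, hN6⟩ :=
    LocalIndex.exists_smul_of_kodairaSymbolOfMinimal_eq_IIIstar M hT
  set N := D • M with hN
  have hN1' : N.a₁ ∈ maximalIdeal O ^ 1 := by rwa [pow_one]
  have hb₂ : N.b₂ ∈ maximalIdeal O ^ 2 := OggBound.b₂_mem_pow N (n₁ := 1) (n₂ := 2) hN1' hN2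
  have hb₄ : N.b₄ ∈ maximalIdeal O ^ 3 :=
    OggBound.b₄_mem_pow N (n₁ := 1) (n₃ := 3) (n₄ := 3) hN1' hN3 hN4
  have hb₆ : N.b₆ ∈ maximalIdeal O ^ 5 := OggBound.b₆_mem_pow N (n₃ := 3) (n₆ := 5) hN3 hN6
  obtain ⟨β₂, hβ₂⟩ := (mem_maximalIdeal_pow_iff_dvd_of_irreducible hϖ _ _).mp hb₂
  obtain ⟨β₄, hβ₄⟩ := (mem_maximalIdeal_pow_iff_dvd_of_irreducible hϖ _ _).mp hb₄
  obtain ⟨β₆, hβ₆⟩ := (mem_maximalIdeal_pow_iff_dvd_of_irreducible hϖ _ _).mp hb₆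
  obtain ⟨n, u₀, hMu⟩ := IsDiscreteValuationRing.eq_unit_mul_pow_irreducible hΔM0 hϖ
  have hn9 : n = 9 := by
    have h := IsDiscreteValuationRing.addVal_def M.Δ u₀ hϖ n hMu
    rw [h] at hordM
    simpa using hordM
  rw [hn9] at hMu
  have hΔN : N.Δ = ϖ ^ 9 * (↑D.u⁻¹ ^ 12 * ↑u₀) := by
    rw [hN, variableChange_Δ, hMu]; ring
  have hδ : IsUnit ((↑D.u⁻¹ ^ 12 * ↑u₀ : O)) := ((Units.isUnit _).pow 12).mul (Units.isUnit _)
  obtain ⟨C₀, hC₀⟩ : ∃ C₀ : VariableChange (v.adicCompletion K'),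
      C₀ • X.baseChange (v.adicCompletion K') = X.localMinimalModel v := ⟨_, rfl⟩
  have hMK : M.map (algebraMap O (v.adicCompletion K')) = X.localMinimalModel v := by
    rw [hM, localMinimalIntegralModel]
    exact baseChange_integralModel_eq O (X.localMinimalModel v)
  have hNK : N.map (algebraMap O (v.adicCompletion K')) =
      (D.map (algebraMap O (v.adicCompletion K')) * C₀) • X.baseChange (v.adicCompletion K') := by
    rw [mul_smul, hC₀, ← hMK, hN, map_variableChange]
  refine ⟨D.map (algebraMap O (v.adicCompletion K')) * C₀, β₂, β₄, β₆, _, hδ, ?_, ?_, ?_, ?_⟩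
  · rw [← hNK, map_b₂, hβ₂, map_mul, map_pow]; rfl
  · rw [← hNK, map_b₄, hβ₄, map_mul, map_pow]; rfl
  · rw [← hNK, map_b₆, hβ₆, map_mul, map_pow]; rfl
  · rw [← hNK, map_Δ, hΔN, map_mul, map_pow]; rfl

end Dedekind


/-! ## §4. Over a number field: the wild ramification groups fix the prime-to-`v` torsion at the
places of type `III`, `III*`; tameness; Ogg's formula there -/

section NumberField

variable (ℓ : ℕ) [Fact ℓ.Prime]

/-- **Wild inertia fixes the prime-to-`v` torsion when a good model exists over `K_v(π^{1/4})`,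
`v ∤ 2`.**  For an elliptic curve `E/K` over a number field, a finite place `v ∤ 2`, a uniformiser
`π ∈ K` at `v`, and the hypothesis that for every fourth root `ϖ ∈ K̄_v` of `π` some change of
variables over `K_v(ϖ)` makes `E` `|·|_v`-integral with unit discriminant: every `σ` in a wild
ramification group `Γ_K^u(𝔓)`, `u > 0`, `𝔓 ∣ v`, fixes every `P ∈ E(K̄)` with `mP = O`,
`v ∤ m`.  Proof: `σ ∈ I_𝔓` fixes the fourth roots of `π` in `K̄`
(`smul_eq_self_of_mem_absUpperRamificationSubgroup_of_mem_adjoin_rootSet_four`); cutting `𝔓` out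
by an embedding `ι : K̄ → K̄_v` (`exists_smul_eq_of_mem_primesAbove_holds`, `primeBelow_comp`),
a local `σ_v ∈ I_𝔐` above `σ` (`exists_mem_inertia_apply_eq_holds`, Neukirch II (9.6)) fixes
`ϖ = ι(ϖ₀)` and hence `K_v(ϖ)` (`IntermediateField.fixedField`), so fixes `ι_* P`
(`smul_localPoints_eq_of_mem_inertia_of_model`), and `ι_*` is injective and equivariant
(`pointsMapOfEmb_smul`, `resGalOfEmb_eq_of_apply_eq`).
[cite: SilvermanAEC2009, Prop. VII.4.1(a) with VII.5 (potential good reduction) and X.4 (proof of Thm. 4.2(b))]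
[cite: SerreLocalFields1979, Ch. IV §2 Cor. 3 of Prop. 7] -/
theorem smul_torsion_eq_self_of_mem_absUpperRamificationSubgroup_of_model [W.IsElliptic]
    {v : HeightOneSpectrum (𝓞 K)} (h2 : (2 : 𝓞 K) ∉ v.asIdeal) {π : K}
    (hπ : v.valuation K π = WithZero.exp (-1 : ℤ))
    (hmodel : ∀ {w : Valuation (AlgebraicClosure (v.adicCompletion K)) ℝ≥0}
      (_hw : ∀ x, (w x : ℝ) =
        spectralNorm (v.adicCompletion K) (AlgebraicClosure (v.adicCompletion K)) x)
      {ϖ : AlgebraicClosure (v.adicCompletion K)}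
      (_hϖ : ϖ ^ 4 = algebraMap (v.adicCompletion K) (AlgebraicClosure (v.adicCompletion K))
        (π : v.adicCompletion K)),
      ∃ (C : VariableChange (v.adicCompletion K))
        (D : VariableChange (IntermediateField.adjoin (v.adicCompletion K) {ϖ})),
        ((D • ((C • W.baseChange (v.adicCompletion K)).baseChange
            (IntermediateField.adjoin (v.adicCompletion K) {ϖ}))).baseChange
          (AlgebraicClosure (v.adicCompletion K))).IsIntegral w.integer ∧
        w ((D • ((C • W.baseChange (v.adicCompletion K)).baseChange
            (IntermediateField.adjoin (v.adicCompletion K) {ϖ}))).baseChange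
          (AlgebraicClosure (v.adicCompletion K))).Δ = 1)
    {𝔓 : Ideal (absIntegers (𝓞 K) K)} (h𝔓 : 𝔓 ∈ v.primesAbove) {u : ℝ} (hu : 0 < u)
    {σ : absoluteGaloisGroup K} (hσ : σ ∈ absUpperRamificationSubgroup (𝓞 K) 𝔓 u)
    {m : ℕ} (hm : (m : 𝓞 K) ∉ v.asIdeal) (P : geomPoints W) (hP : m • P = 0) : σ • P = P := by
  let Kv := v.adicCompletion K
  let L := AlgebraicClosure (v.adicCompletion K)
  -- `σ ∈ I_𝔓` fixes the fourth roots of `π` in `K̄`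
  have hπ0 : π ≠ 0 := by
    rintro rfl
    rw [map_zero] at hπ
    exact WithZero.exp_ne_zero hπ.symm
  have hσI : σ ∈ 𝔓.inertia (absoluteGaloisGroup K) :=
    absUpperRamificationSubgroup_le_inertia_holds (𝓞 K) 𝔓 u hσ
  obtain ⟨ϖ₀, hϖ₀⟩ := IsAlgClosed.exists_pow_nat_eq (algebraMap K (AlgebraicClosure K) π)
    (by norm_num : 0 < 4)
  have hϖ₀mem : ϖ₀ ∈ IntermediateField.adjoin K
      ((X ^ 4 - Polynomial.C π : K[X]).rootSet (AlgebraicClosure K)) :=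
    IntermediateField.subset_adjoin K _
      (mem_rootSet.mpr ⟨X_pow_sub_C_ne_zero (by norm_num) _, by simp [hϖ₀]⟩)
  have hσϖ₀ : σ • ϖ₀ = ϖ₀ :=
    smul_eq_self_of_mem_absUpperRamificationSubgroup_of_mem_adjoin_rootSet_four hπ0 h2 h𝔓 hu hσ
      hϖ₀mem
  -- cut `𝔓` out by an embedding `ι : K̄ → K̄_v`
  obtain ⟨𝔐, h𝔐⟩ := v.localPrimesAbove_nonempty
  obtain ⟨g, hg⟩ := HeightOneSpectrum.exists_smul_eq_of_mem_primesAbove_holds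
    (HeightOneSpectrum.primeBelow_mem_primesAbove (ι := closureEmb (K := K) Kv) h𝔐) h𝔓
  set ι : AlgebraicClosure K →ₐ[K] L := (closureEmb (K := K) Kv).comp
    ((show AlgebraicClosure K ≃ₐ[K] AlgebraicClosure K from g⁻¹) :
      AlgebraicClosure K →ₐ[K] AlgebraicClosure K) with hι
  have h1 : 𝔓 = v.primeBelow ι 𝔐 := by
    rw [hι, HeightOneSpectrum.primeBelow_comp, ← hg]
    exact congrArg (· • _) (inv_inv g).symm
  -- a local element `σv ∈ I_𝔐` above `σ`
  obtain ⟨σv, hσvI, hσv⟩ := v.exists_mem_inertia_apply_eq_holds ι h𝔐 (τ := σ)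
    (by rw [← h1]; exact hσI)
  -- `ϖ = ι ϖ₀`, a fourth root of `π` in `K̄_v`, is fixed by `σv`, hence so is `K_v(ϖ)`
  set ϖ : L := ι ϖ₀ with hϖdef
  have hcoe : algebraMap K Kv π = (π : Kv) := by rw [algebraMap_adicCompletion]; rfl
  have hϖ4 : ϖ ^ 4 = algebraMap Kv L (π : Kv) := by
    rw [hϖdef, ← map_pow, hϖ₀, AlgHom.commutes, IsScalarTower.algebraMap_apply K Kv L, hcoe]
  have hσvϖ : σv • ϖ = ϖ := by rw [hϖdef, ← hσv, hσϖ₀]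
  have hσvF : ∀ x : L, x ∈ IntermediateField.adjoin Kv {ϖ} → σv • x = x := by
    intro x hx
    set σE : L ≃ₐ[Kv] L := absoluteGaloisGroup.toAlgEquiv _ σv with hσE
    let H : Subgroup (L ≃ₐ[Kv] L) := MulAction.stabilizer (L ≃ₐ[Kv] L) ϖ
    have hϖH : ϖ ∈ IntermediateField.fixedField H := by
      rw [IntermediateField.mem_fixedField_iff]
      intro f hf
      rw [← AlgEquiv.smul_def]
      exact MulAction.mem_stabilizer_iff.mp hf
    have hle : IntermediateField.adjoin Kv {ϖ} ≤ IntermediateField.fixedField H :=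
      IntermediateField.adjoin_simple_le_iff.mpr hϖH
    have hσEH : σE ∈ H := by
      rw [MulAction.mem_stabilizer_iff, AlgEquiv.smul_def]
      exact hσvϖ
    exact ((IntermediateField.mem_fixedField_iff H x).mp (hle hx)) σE hσEH
  -- the good model over `K_v(ϖ)` and the local reduction step
  obtain ⟨w, hw⟩ := v.exists_spectralValuation
  obtain ⟨C, D, hint, hΔ⟩ := hmodel hw hϖ4
  haveI := hint
  have hQ : (m : ℤ) • pointsMapOfEmb W ι P = 0 := by
    rw [natCast_zsmul, ← map_nsmul, hP, map_zero]
  have key := W.smul_localPoints_eq_of_mem_inertia_of_model hw h𝔐 _ C D hΔ hσvI hσvF (n := m)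
    (by exact_mod_cast hm) hQ
  -- back to `K̄` along `ι`
  have hres : resGalOfEmb ι σv = σ := resGalOfEmb_eq_of_apply_eq ι hσv
  apply pointsMapOfEmb_injective W ι
  rw [← hres, pointsMapOfEmb_smul]
  exact key

variable {ℓ} in
omit [NumberField K] in
/-- `2 ∉ v` from `ringChar (𝓞 K ⧸ v) ≠ 2`. [folklore] -/
theorem two_notMem_of_ringChar_ne_two {v : HeightOneSpectrum (𝓞 K)}
    (h2 : ringChar (𝓞 K ⧸ v.asIdeal) ≠ 2) : (2 : 𝓞 K) ∉ v.asIdeal := by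
  intro hmem
  apply Ring.two_ne_zero h2
  rw [← map_ofNat (Ideal.Quotient.mk v.asIdeal) 2, Ideal.Quotient.eq_zero_iff_mem]
  exact hmem

/-- **Wild inertia fixes the prime-to-`v` torsion at a place `v ∤ 2` of Kodaira type `III`**
(good reduction over `K_v(π^{1/4})`: `exists_variableChange_b_of_kodairaSymbolAt_eq_III`,
`exists_model_adjoin_root_four` with `k = 1`; Silverman *ATAEC* p. 367, "`L/K` is at worst tamely
ramified", in a form valid for all `ℓ`).
[cite: SilvermanATAEC1994, proof of IV.11.1, p = 3, type III (PDF p. 367)] -/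
theorem smul_torsion_eq_self_of_mem_absUpperRamificationSubgroup_of_kodairaSymbolAt_eq_III
    [W.IsElliptic] {v : HeightOneSpectrum (𝓞 K)} (h2 : ringChar (𝓞 K ⧸ v.asIdeal) ≠ 2)
    (hT : W.kodairaSymbolAt v = .III)
    {𝔓 : Ideal (absIntegers (𝓞 K) K)} (h𝔓 : 𝔓 ∈ v.primesAbove) {u : ℝ} (hu : 0 < u)
    {σ : absoluteGaloisGroup K} (hσ : σ ∈ absUpperRamificationSubgroup (𝓞 K) 𝔓 u)
    {m : ℕ} (hm : (m : 𝓞 K) ∉ v.asIdeal) (P : geomPoints W) (hP : m • P = 0) : σ • P = P := by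
  haveI : PerfectField (ResidueField (v.adicCompletionIntegers K)) := PerfectField.ofFinite
  obtain ⟨π, hπ⟩ := v.valuation_exists_uniformizer K
  have hu2 := HeightOneSpectrum.isUnit_two_adicCompletionIntegers K v h2
  refine W.smul_torsion_eq_self_of_mem_absUpperRamificationSubgroup_of_model
    (two_notMem_of_ringChar_ne_two h2) hπ ?_ h𝔓 hu hσ hm P hP
  intro w hw ϖ hϖ
  obtain ⟨C, β₂, β₄, β₆, δ, hδ, hb₂, hb₄, hb₆, hΔ⟩ :=
    W.exists_variableChange_b_of_kodairaSymbolAt_eq_III v h2 hT hπ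
  obtain ⟨D, hD⟩ := W.exists_model_adjoin_root_four hw C hπ hu2 hδ hb₂ hb₄ hb₆ hΔ (k := 1)
    (by norm_num) (by norm_num) (by norm_num) (by norm_num) hϖ
  exact ⟨C, D, hD⟩

/-- **Wild inertia fixes the prime-to-`v` torsion at a place `v ∤ 2` of Kodaira type `III*`**
(good reduction over `K_v(π^{1/4})`: `exists_variableChange_b_of_kodairaSymbolAt_eq_IIIstar`,
`exists_model_adjoin_root_four` with `k = 3`; Silverman *ATAEC* p. 367).
[cite: SilvermanATAEC1994, proof of IV.11.1, p = 3, type III* (PDF p. 367)] -/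
theorem smul_torsion_eq_self_of_mem_absUpperRamificationSubgroup_of_kodairaSymbolAt_eq_IIIstar
    [W.IsElliptic] {v : HeightOneSpectrum (𝓞 K)} (h2 : ringChar (𝓞 K ⧸ v.asIdeal) ≠ 2)
    (hT : W.kodairaSymbolAt v = .IIIstar)
    {𝔓 : Ideal (absIntegers (𝓞 K) K)} (h𝔓 : 𝔓 ∈ v.primesAbove) {u : ℝ} (hu : 0 < u)
    {σ : absoluteGaloisGroup K} (hσ : σ ∈ absUpperRamificationSubgroup (𝓞 K) 𝔓 u)
    {m : ℕ} (hm : (m : 𝓞 K) ∉ v.asIdeal) (P : geomPoints W) (hP : m • P = 0) : σ • P = P := by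
  haveI : PerfectField (ResidueField (v.adicCompletionIntegers K)) := PerfectField.ofFinite
  obtain ⟨π, hπ⟩ := v.valuation_exists_uniformizer K
  have hu2 := HeightOneSpectrum.isUnit_two_adicCompletionIntegers K v h2
  refine W.smul_torsion_eq_self_of_mem_absUpperRamificationSubgroup_of_model
    (two_notMem_of_ringChar_ne_two h2) hπ ?_ h𝔓 hu hσ hm P hP
  intro w hw ϖ hϖ
  obtain ⟨C, β₂, β₄, β₆, δ, hδ, hb₂, hb₄, hb₆, hΔ⟩ :=
    W.exists_variableChange_b_of_kodairaSymbolAt_eq_IIIstar v h2 hT hπ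
  obtain ⟨D, hD⟩ := W.exists_model_adjoin_root_four hw C hπ hu2 hδ hb₂ hb₄ hb₆ hΔ (k := 3)
    (by norm_num) (by norm_num) (by norm_num) (by norm_num) hϖ
  exact ⟨C, D, hD⟩

/-- **`V_ℓ E` is tamely ramified at a place `v ∤ 2ℓ` of Kodaira type `III` or `III*`** (Silverman
*ATAEC* IV.11.1, `p = 3`, types `III`, `III*`, p. 367: "`δ(E/K) = 0`", here for every `ℓ` and
every odd residue characteristic): the wild ramification groups fix every `E[ℓⁿ]`
(`smul_torsion_eq_self_…_of_kodairaSymbolAt_eq_III` /`_IIIstar`), hence act trivially on `V_ℓ E`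
(`isTameAt_rationalTateGaloisRepOf_of_forall_smul_torsion_eq`).
[cite: SilvermanATAEC1994, proof of IV.11.1, p = 3, types III and III* (PDF p. 367)] -/
theorem isTameAt_rationalTate_of_kodairaSymbolAt_eq_III_or_IIIstar [W.IsElliptic]
    (h : Continuous fun x : absoluteGaloisGroup K × RationalTateModule (geomPoints W) ℓ ↦
      rationalTateRepresentation (absoluteGaloisGroup K) (geomPoints W) ℓ x.1 x.2)
    {v : HeightOneSpectrum (𝓞 K)} (hℓ : (ℓ : 𝓞 K) ∉ v.asIdeal)
    (h2 : ringChar (𝓞 K ⧸ v.asIdeal) ≠ 2)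
    (hT : W.kodairaSymbolAt v = .III ∨ W.kodairaSymbolAt v = .IIIstar)
    {𝔓 : Ideal (absIntegers (𝓞 K) K)} (h𝔓 : 𝔓 ∈ v.primesAbove) :
    (rationalTateGaloisRepOf (geomPoints W) ℓ h).IsTameAt (𝓞 K) 𝔓 := by
  refine W.isTameAt_rationalTateGaloisRepOf_of_forall_smul_torsion_eq ℓ h fun u hu σ hσ n P hP ↦ ?_
  have hm : ((ℓ ^ n : ℕ) : 𝓞 K) ∉ v.asIdeal := by
    rw [Nat.cast_pow]
    exact fun h' ↦ hℓ (v.isPrime.mem_of_pow_mem n h')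
  rcases hT with hT | hT
  · exact W.smul_torsion_eq_self_of_mem_absUpperRamificationSubgroup_of_kodairaSymbolAt_eq_III h2 hT
      h𝔓 hu hσ hm P hP
  · exact W.smul_torsion_eq_self_of_mem_absUpperRamificationSubgroup_of_kodairaSymbolAt_eq_IIIstar
      h2 hT h𝔓 hu hσ hm P hP

/-- **`Sw_𝔓(V_ℓ E) = 0` at a place `v ∤ 2ℓ` of Kodaira type `III` or `III*`**
(`isTameAt_rationalTate_of_kodairaSymbolAt_eq_III_or_IIIstar`).
[cite: SilvermanATAEC1994, proof of IV.11.1, p = 3, types III and III* (PDF p. 367)] -/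
theorem swanConductorAt_rationalTate_eq_zero_of_kodairaSymbolAt_eq_III_or_IIIstar [W.IsElliptic]
    (h : Continuous fun x : absoluteGaloisGroup K × RationalTateModule (geomPoints W) ℓ ↦
      rationalTateRepresentation (absoluteGaloisGroup K) (geomPoints W) ℓ x.1 x.2)
    {v : HeightOneSpectrum (𝓞 K)} (hℓ : (ℓ : 𝓞 K) ∉ v.asIdeal)
    (h2 : ringChar (𝓞 K ⧸ v.asIdeal) ≠ 2)
    (hT : W.kodairaSymbolAt v = .III ∨ W.kodairaSymbolAt v = .IIIstar)
    {𝔓 : Ideal (absIntegers (𝓞 K) K)} (h𝔓 : 𝔓 ∈ v.primesAbove) :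
    (rationalTateGaloisRepOf (geomPoints W) ℓ h).swanConductorAt (𝓞 K) 𝔓 = 0 :=
  (W.isTameAt_rationalTate_of_kodairaSymbolAt_eq_III_or_IIIstar ℓ h hℓ h2 hT h𝔓).swanConductorAt_eq_zero

/-- **Ogg's formula in Galois form at the places `v ∤ 2ℓ` of Kodaira type `III` or `III*`**:
`Sw_𝔓(V_ℓ E) = δ_v`, both sides vanishing
(`swanConductorAt_rationalTate_eq_zero_of_kodairaSymbolAt_eq_III_or_IIIstar`;
`wildConductorExponent_eq_zero_of_kodairaSymbolAt`: `f_v = 3 + 1 - 2 = 2`, resp. `9 + 1 - 8 = 2`).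
This is Silverman's "`v_K(𝒟_{E/K}) - f(E/K) - m(E/K) + 1 = 3 - (2+0) - 2 + 1 = 0`" and
"`= 9 - (2+0) - 8 + 1 = 0`" (*ATAEC* p. 367), i.e. the conclusion of the named fact
`swanConductorAt_rationalTate_eq_wildConductorExponent_of_ringChar_eq_three W ℓ` at these places.
[cite: SilvermanATAEC1994, Thm. IV.11.1 and its proof for p = 3, types III, III* (PDF p. 367)] -/
theorem swanConductorAt_rationalTate_eq_wildConductorExponent_of_kodairaSymbolAt_eq_III_or_IIIstar
    [W.IsElliptic]
    (h : Continuous fun x : absoluteGaloisGroup K × RationalTateModule (geomPoints W) ℓ ↦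
      rationalTateRepresentation (absoluteGaloisGroup K) (geomPoints W) ℓ x.1 x.2)
    {v : HeightOneSpectrum (𝓞 K)} (hℓ : (ℓ : 𝓞 K) ∉ v.asIdeal)
    (h2 : ringChar (𝓞 K ⧸ v.asIdeal) ≠ 2)
    (hT : W.kodairaSymbolAt v = .III ∨ W.kodairaSymbolAt v = .IIIstar)
    {𝔓 : Ideal (absIntegers (𝓞 K) K)} (h𝔓 : 𝔓 ∈ v.primesAbove) :
    (rationalTateGaloisRepOf (geomPoints W) ℓ h).swanConductorAt (𝓞 K) 𝔓 =
      (W.wildConductorExponent v : ℝ) := by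
  haveI : PerfectField (ResidueField (v.adicCompletionIntegers K)) := PerfectField.ofFinite
  have hT' : W.kodairaSymbolAt v = .III ∨ W.kodairaSymbolAt v = .IIIstar ∨
      ∃ n, W.kodairaSymbolAt v = .Istar n := by
    rcases hT with hT | hT
    · exact Or.inl hT
    · exact Or.inr (Or.inl hT)
  rw [W.swanConductorAt_rationalTate_eq_zero_of_kodairaSymbolAt_eq_III_or_IIIstar ℓ h hℓ h2 hT h𝔓,
    W.wildConductorExponent_eq_zero_of_kodairaSymbolAt v h2 hT', Nat.cast_zero]

/-! ### Ogg's `p = 3` theorem reduced to the wild Kodaira types `II, IV, IV*, II*` -/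

/-- **Ogg's formula at `p = 3` (the named fact
`swanConductorAt_rationalTate_eq_wildConductorExponent_of_ringChar_eq_three W ℓ`) follows from its
restriction to the additive places of residue characteristic `3` of Kodaira type `II`, `IV`,
`IV*` or `II*`.**  The types `III`, `III*` are
`swanConductorAt_rationalTate_eq_wildConductorExponent_of_kodairaSymbolAt_eq_III_or_IIIstar`, the
types `Iₙ*` are `…_of_kodairaSymbolAt_eq_Istar` (`OggFormulaTypeIstarProofs`), and the types `Iₙ`
do not occur at an additive place (`isAdditive_kodairaSymbolAt_iff_holds`).  What remains of
Silverman's case analysis (*ATAEC* pp. 366–371) is the computation with the `2`-torsion field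
for the four genuinely wild types (columns `II`, `IV`, `IV*`, `II*` of the table on p. 368 and the
type-`IV`/`IV*` computation of pp. 369–371).
[cite: SilvermanATAEC1994, Thm. IV.11.1 and its proof for p = 3 (PDF pp. 366–371)] -/
theorem swanConductorAt_rationalTate_eq_wildConductorExponent_of_ringChar_eq_three_of_wildTypes
    (hrest : ∀ [W.IsElliptic]
      (h : Continuous fun x : absoluteGaloisGroup K × RationalTateModule (geomPoints W) ℓ ↦
        rationalTateRepresentation (absoluteGaloisGroup K) (geomPoints W) ℓ x.1 x.2)
      (v : HeightOneSpectrum (𝓞 K)) (_hℓ : (ℓ : 𝓞 K) ∉ v.asIdeal)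
      (_hv : W.HasAdditiveReductionAt v) (_h3 : ringChar (𝓞 K ⧸ v.asIdeal) = 3)
      (_hT : W.kodairaSymbolAt v = .II ∨ W.kodairaSymbolAt v = .IV ∨
        W.kodairaSymbolAt v = .IVstar ∨ W.kodairaSymbolAt v = .IIstar)
      {𝔓 : Ideal (absIntegers (𝓞 K) K)} (_h𝔓 : 𝔓 ∈ v.primesAbove),
      (rationalTateGaloisRepOf (geomPoints W) ℓ h).swanConductorAt (𝓞 K) 𝔓 =
        (W.wildConductorExponent v : ℝ)) :
    W.swanConductorAt_rationalTate_eq_wildConductorExponent_of_ringChar_eq_three ℓ := by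
  refine W.swanConductorAt_rationalTate_eq_wildConductorExponent_of_ringChar_eq_three_of_ne_Istar ℓ
    ?_
  intro _ h v hℓ hv h3 hI 𝔓 h𝔓
  haveI : PerfectField (ResidueField (v.adicCompletionIntegers K)) := PerfectField.ofFinite
  have h2 : ringChar (𝓞 K ⧸ v.asIdeal) ≠ 2 := by rw [h3]; decide
  have hadd : (W.kodairaSymbolAt v).IsAdditive := (W.isAdditive_kodairaSymbolAt_iff_holds v).mpr hv
  cases hK : W.kodairaSymbolAt v with
  | I n =>
    exfalso
    rw [hK] at hadd
    rcases n with _ | n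
    · exact hadd.1 rfl
    · exact hadd.2 ⟨n + 1, n.succ_ne_zero, rfl⟩
  | II => exact hrest h v hℓ hv h3 (Or.inl hK) h𝔓
  | III =>
    exact W.swanConductorAt_rationalTate_eq_wildConductorExponent_of_kodairaSymbolAt_eq_III_or_IIIstar
      ℓ h hℓ h2 (Or.inl hK) h𝔓
  | IV => exact hrest h v hℓ hv h3 (Or.inr (Or.inl hK)) h𝔓
  | Istar n => exact absurd hK (hI n)
  | IVstar => exact hrest h v hℓ hv h3 (Or.inr (Or.inr (Or.inl hK))) h𝔓
  | IIIstar =>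
    exact W.swanConductorAt_rationalTate_eq_wildConductorExponent_of_kodairaSymbolAt_eq_III_or_IIIstar
      ℓ h hℓ h2 (Or.inr hK) h𝔓
  | IIstar => exact hrest h v hℓ hv h3 (Or.inr (Or.inr (Or.inr hK))) h𝔓

end NumberField

end WeierstrassCurve

end
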